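import Mathlib.Algebra.Field.Subfield.Basic
import Mathlib.LinearAlgebra.Basis.VectorSpace
import Mathlib.Data.Matrix.Mul
import HarnessLib

/-!
# Ribet's non-split lattice over `ℤ̄_p` — II. Descent of residual coboundary solutions to a subfield

Lead prover-line-stmt-Langlands-13639-c2-0 (line `sector-klingen-split`, crux `ResiduallyYoshidaLifting`,
stmt-Langlands-13639), toward the registered stub `stub_ribetNonsplitLattice`.

A bookkeeping tool of the direct proof of Ribet's lemma over the non-discrete valuation ring `𝒪 = 𝒪_{ℚ̄_p}`
(where residual coboundary equations must be solved RATIONALLY over the residue field of a finite extension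
`E/ℚ_p` so that an iteration stays inside `E`): `coboundary_descent` — pure linear algebra over a field `κ` with
a subfield `k₁`: if the Sylvester-type system `b i = A i · X - X · D i` (all coefficient matrices `k₁`-rational)
has a solution `X` over `κ`, it has a `k₁`-rational one (apply a `k₁`-linear retraction `κ → k₁` entrywise).
Elementary. [folklore]
-/

noncomputable section

open Matrix

-- `Summit.Langlands.Langlands.…` (summit = sub-problem name, D-0017 layout) trips `dupNamespace` on every decl.
set_option linter.dupNamespace false
set_option autoImplicit false

namespace Summit.Langlands.Langlands.Cruxes.ResiduallyYoshidaLifting.SectorKlingenSplit.Ribet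

/-! ### Descent of solutions of `b = A X - X D` to a subfield -/

section Descent

variable {κ : Type*} [Field κ] (k₁ : Subfield κ)

/-- A `k₁`-linear retraction of `κ` onto the subfield `k₁` (a complement of `k₁` in the `k₁`-vector space
`κ` exists). [folklore] -/
theorem exists_retraction : ∃ π : κ →ₗ[k₁] k₁, ∀ x : k₁, π (x : κ) = x := by
  obtain ⟨π, hπ⟩ := LinearMap.exists_leftInverse_of_injective (Algebra.linearMap k₁ κ)
    (LinearMap.ker_eq_bot.2 (fun x y h => Subtype.ext h))
  exact ⟨π, fun x => LinearMap.congr_fun hπ x⟩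

/-- **Descent of coboundary solutions.**  Let `k₁ ⊆ κ` be a subfield and `A i`, `D i`, `b i` (`i ∈ ι`)
matrices with entries in `k₁`.  If `b i = A i · X - X · D i` for all `i` has a solution `X` over `κ`, then it
has a solution with entries in `k₁`. [folklore] -/
theorem coboundary_descent {ι m n : Type*} [Fintype m] [Fintype n]
    (A : ι → Matrix m m κ) (D : ι → Matrix n n κ) (b : ι → Matrix m n κ)
    (hA : ∀ i a c, A i a c ∈ k₁) (hD : ∀ i a c, D i a c ∈ k₁) (hb : ∀ i a c, b i a c ∈ k₁)
    {X : Matrix m n κ} (hX : ∀ i, b i = A i * X - X * D i) :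
    ∃ X₁ : Matrix m n κ, (∀ a c, X₁ a c ∈ k₁) ∧ ∀ i, b i = A i * X₁ - X₁ * D i := by
  obtain ⟨π, hπ⟩ := exists_retraction k₁
  -- the retraction, as a map `κ → κ`
  let π' : κ → κ := fun x => (π x : κ)
  have hπ'add : ∀ x y, π' (x + y) = π' x + π' y := fun x y => by simp [π']
  have hπ'sub : ∀ x y, π' (x - y) = π' x - π' y := fun x y => by simp [π']
  have hπ'mul : ∀ (a : κ), a ∈ k₁ → ∀ x, π' (a * x) = a * π' x := by
    intro a ha x
    have h := π.map_smul (⟨a, ha⟩ : k₁) x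
    simp only [π']
    change (π ((⟨a, ha⟩ : k₁) • x) : κ) = a * (π x : κ)
    rw [h]
    rfl
  have hπ'mul' : ∀ (a : κ), a ∈ k₁ → ∀ x, π' (x * a) = π' x * a := by
    intro a ha x
    rw [mul_comm, hπ'mul a ha, mul_comm]
  have hπ'fix : ∀ a : κ, a ∈ k₁ → π' a = a := fun a ha => by
    simpa [π'] using congrArg (fun y : k₁ => (y : κ)) (hπ ⟨a, ha⟩)
  have hπ'sum : ∀ (s : Finset m) (f : m → κ), π' (∑ e ∈ s, f e) = ∑ e ∈ s, π' (f e) := by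
    intro s f
    simp [π', map_sum]
  have hπ'sum' : ∀ (s : Finset n) (f : n → κ), π' (∑ e ∈ s, f e) = ∑ e ∈ s, π' (f e) := by
    intro s f
    simp [π', map_sum]
  refine ⟨X.map π', fun a c => (π (X a c)).2, fun i => ?_⟩
  have key : (A i * X - X * D i).map π' = A i * X.map π' - X.map π' * D i := by
    ext a c
    simp only [Matrix.map_apply, Matrix.sub_apply, Matrix.mul_apply, hπ'sub, hπ'sum, hπ'sum']
    congr 1
    · exact Finset.sum_congr rfl fun e _ => hπ'mul _ (hA i a e) _
    · exact Finset.sum_congr rfl fun e _ => hπ'mul' _ (hD i e c) _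
  have hbfix : (b i).map π' = b i := by
    ext a c
    exact hπ'fix _ (hb i a c)
  rw [← key, ← hX i, hbfix]

end Descent


/-- **Registered statement `stub_ribetCoboundaryDescent`** (wrapper of `coboundary_descent` with explicit
binders, the form recorded on the crux item). [folklore] -/
theorem stub_ribetCoboundaryDescent :
    ∀ (κ : Type) [Field κ] (k₁ : Subfield κ) (ι m n : Type) [Fintype m] [Fintype n]
      (A : ι → Matrix m m κ) (D : ι → Matrix n n κ) (b : ι → Matrix m n κ),
      (∀ i a c, A i a c ∈ k₁) → (∀ i a c, D i a c ∈ k₁) → (∀ i a c, b i a c ∈ k₁) →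
      (∃ X : Matrix m n κ, ∀ i, b i = A i * X - X * D i) →
      ∃ X₁ : Matrix m n κ, (∀ a c, X₁ a c ∈ k₁) ∧ ∀ i, b i = A i * X₁ - X₁ * D i := by
  intro κ _ k₁ ι m n _ _ A D b hA hD hb hX
  obtain ⟨X, hX⟩ := hX
  exact coboundary_descent k₁ A D b hA hD hb hX

end Summit.Langlands.Langlands.Cruxes.ResiduallyYoshidaLifting.SectorKlingenSplit.Ribet

end
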